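import Summits.ResolutionOfSingularities.ResolutionOfSingularities.Theorems.WeightedInvariantLocalWeightedDropNCDirectrixCutHist


/-!
# `LocalWeightedDrop`: RD-ALIGNMENT of the wild residuals and the DIRECTRIX CUT of the equimultiple phase
# (strategist line `directrix-cut` for W4|₄ = `stub_wildWideApexFourStartsWon`; the phase assembly is generic in the dimension)

[ADOPTION RECORD: this tree module is one of four files (`…NCDirectrixCutAlign` ← `…NCDirectrixCutPhase` ← `…NCDirectrixCutHist` ←
`…NCDirectrixCut`) into which res-L1-w43-stub-4 (gen 5, adoption hand, 2026-08-27) split res-L1-w43-strat-1's farm-clean strategist module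
`L/res-L1-w43-strat-1/g8/directrix_cut_v3_1.lean` (sha16 25b57d7ac1dae990, gens 7–8; offer (i) 14:58:21Z), because of the lint «Theorems files with
proofs ≤ 400 lines».  Declaration texts are VERBATIM with ONE systematic edit: the notational `abbrev Decoration.IsInv` of the source is UNFOLDED in
place and not declared (res-L1-w43-lead-1's regime vocabulary `…NCResRegimeDefs` declares `Decoration.IsInv` with the same meaning).  Author of the
mathematics and the text: res-L1-w43-strat-1.  The module-level commentary below is the author's, kept whole in each part for context.]

THIS PART (4/4): §4/§6 — BY NAME (W4|₄ from the directrix cut and from the history-first cut; the door text verbatim) and §7 — the ladder in every dimension and the T″|₅ seam.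

[OURS · L1 W4.3 · chain w43 · ENGINE crux `LocalWeightedDrop` stmt-ResolutionOfSingularities-8899; registered skeleton of record v32
(`L/res-L1-w43-lead-1/g4/LocalWeightedDrop_v32.lean`, sha16 ddb48572591139d5, registrar res-L1-w43-lead-1); strategist res-L1-w43-strat-1 gens 7–8 (v3: §5–§6 added in gen 8).
Game bookkeeping over the programme's own NC count game (res-type-056 / res-L1-w43-stub-1's S-SET decorations); NOT a statement of any manuscript;
AI-produced, weaker than expert review.  This file closes NO registered stub by name: it proves the residuals WITH EXTRA HYPOTHESES (named below).]

## §1  RD-alignment: the ORDINAL transport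
`won_of_winsOrd` — the transport `won_of_winsIn` (p507842) with well-founded induction on the GAME VALUE instead of the round number: a
TRANSFINITELY winnable position of the NC count game (`WinsOrd GermIsNC α b`, …NCGameRank) makes every divisor of a power of `b` a won germ of the
weighted game.  Hence the residual stubs follow BY NAME from the ORDINAL RANK-DROP statement
  (RD_m)  `∃ ρ : k⟦x₀..x_m⟧ → Ordinal, ∀ b ≠ 0, ¬ GermIsNC b → ∃ smooth-centre move, ρ drops at every answer`
— literally the text of the registered stub `stub_spaceNCRankDrop` (m = 2) one dimension up — instead of the uniform-in-the-answers finite round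
bound (TOT_m) of p507842: `wildWideApexFourStartsWon_of_ncRankDrop` (W4|₄ ⇐ RD₃), `wildWideApexFiveUpStartsWon_of_ncRankDrop` (W4|₅₊ ⇐ RD_{n+4}),
and — the tame maximal-contact DIMENSION DROP, ordinal form of res-type-088's `tameWideApexHigherStartsWon_of_tot_of_mono` (p506334) —
`tameWideApexFiveUpStartsWon_of_ncRankDropBelow` (T″|₅₊ at `N = n + 5` ⇐ RD_{n+3}, i.e. the NC game in ONE FEWER variable, through
`TameLift.tameWon_of_tupleDrop` + `tupleDrop_of_rank_of_monomialPhase` + `germMonomialPhase`).  So T″|₅ and W4|₄ cost the SAME statement RD₃.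

## §2  The PHASE ASSEMBLY — REBASED (v2) on res-L1-w43-stub-1's landed `…NCResPhaseAssembly` (p534993: product states `k⟦x⟧ × Decoration k m`,
germ `Prod.fst`, `Admissible` carried in the targets; `dWinsTo_germIsNC_of_headPhase`, `ncRankDrop_of_headPhase`, `ncRankDrop_of_highPhase_of_rung`).
This file adds only: `HighExit m` (the `o ≥ 2` phase WITH the normal-crossing exit — CJS-faithful: Σ^{O,max} is eliminated OR the germ resolves;
stub-1's exit-free `hhigh` implies it, `highExit_of_high`), the ORDINAL endgame (`EndOrd m`, `endOrd_of_endR8`, `DWinsTo.of_winsOrd` = transfinite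
wins are decorated wins, `dWinsTo_end_of_ordRung`, `endPhase_of_ordRung[']`), and `rd_of_highExit_of_end` / `rd_of_highExit_of_ordRung :
HighExit m → EndOrd m → RD_m` (so that the rank-drop statement one dimension LOWER can feed the endgame — see the card, stub E).

## §3  The DIRECTRIX CUT of a phase (every `m`; the new decomposition)
`UnaryVertex δ` := the initial form of the TOTAL-WITH-HISTORY `f̃ = f · ∏_{l ∈ O} X_l` (order `c = o + |O|`; TOT2-LINE v1.1 (B): e(f̃) = e^O) is
invariant under `m` linearly independent translations — i.e. `in_c(f̃) = λ·ℓ^c` is a power of ONE linear form, `e(f̃) = m = dim X`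
(over an algebraically closed field the translation-invariance vectors of a form are exactly its directrix: a homogeneous additive stabiliser is a
linear subspace, and invariance under a whole subspace `W` means the form lies in `Sym((V/W)^*)`).  The phase splits as
  `CoreUnary m` := from `e(f̃) = m`, `o ≥ 2`: reach «NC ∨ head drops ∨ (same head ∧ e(f̃) < m)» — split further into `CoreUnaryTame p m`
                   (`O ≠ ∅ ∨ p ∤ o`: maximal contact exists) and `CoreUnaryWild p m` (`O = ∅ ∧ p ∣ o`), classes preserved along equal heads;
  `TermLow m`   := from `e(f̃) < m`, `o ≥ 2`: reach «NC ∨ head drops»;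
  `phase_of_dirCut : CoreUnary m → TermLow m → Phase m` (`DWinsTo.bind`; a state with the same head has the same `o ≥ 2`).
WHY THIS CUT (m = 3, threefold hypersurface germs in 4-space, the wild residual W4|₄).  Cossart–Jannsen–Saito (LNM 2270 = arXiv:0905.2191) p.9:
«the proofs in §§11–13 show that [the key termination] Theorems 5.35 and 5.40 hold for X of ARBITRARY dimension, with the condition that the
geometric dimension of the directrix is ≤ 2»; Thm 2.10(4) (e does not increase at near points) is characteristic- and dimension-free; Thm 2.14
(near points lie on ℙ(Dir)) needs «char ≥ dim X/2 + 1» only through Hironaka's group scheme `B_{P,x′}`, which at a RATIONAL point `x′` is the line of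
`x′` — so at the closed points of our games over `k = k̄` it holds in every characteristic.  Hence `TermLow 3` is CJS-transcription (XL, in print modulo
the quoted remark), `EndOrd 3` is embedded resolution of the boundary-trace SURFACES in the regular threefold `V(f)` (CJS Thm 0.3, dimension two in a
regular ambient scheme of any dimension: in print; inside the programme it is the rank-drop statement `RD 2` — the registered `stub_spaceNCRankDrop` —
plus a sheet-separation lift, see the card), and `CoreUnary 3` — `in_c(f̃) = z^c`, `p ∣ o` forced by the engine's tangent-cone cuts — is THE OPEN
THREEFOLD CORE (the hypersurfaces `z^{p e} + …` of Cossart–Piltant 2008-II, known only by local uniformization).  At `m = 2` the same cut separates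
TOT2-LINE's S-E2′ (unary vertex, the polyhedron regime) from S-E1/S-E0/S-CRV.

## §4  BY NAME
`wildWideApexFourStartsWon_of_dirCut : CoreUnaryWild₃ → CoreUnaryTame₃ → TermLow₃ → EndOrd₃ → W4|₄` (statement of the registered stub VERBATIM), sorry-free;
`spaceNCRankDrop_of_dirCut : CoreUnary₂ → TermLow₂ → EndOrd₂ → (text of stub_spaceNCRankDrop)`.
## §5  The HISTORY-FIRST cut (v3, every `m`) — the cut of record for the line from gen 8 on
`OldExit m` (an old letter is present: the old component is a RIGID hypersurface of maximal contact for free — (P2) + «same head keeps `|O|`»; at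
`m = 3` its content is Kawanoue–Matsuki's IFP resolution in ambient dimension 3, arXiv:1205.4556, applied on the old component, modulo the game
dictionary) · `FreeLow m` (`O = ∅`, `f` not unary: the GENUINE CJS regime — condition (3e) `e_x ≤ 2` holds at `m = 3`) · `FreeTame p m` (`O = ∅`, unary,
`p ∤ o`: Giraud contact + the same threefold marked-ideal game) · `CoreUnaryWild p m` (unchanged: THE open core); `highExit_of_histCut`, `rd_of_histCut`.
The apex sub-cut of `FreeLow`: its `e = 0` and `e = 1`-isolated parts are TREE THEOREMS for every `m` (`dWinsTo_headDrop_of_apexTrivial` p537041,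
`TOT2E1.dWinsTo_headDrop_of_isolated` p536552), leaving `ApexLineCurveExit m` (`e = 1` on an equimultiple formal curve; L, OURS) and `ApexPlaneExit m`
(`2 ≤ e ≤ m - 1`; at `m = 3`: CJS Thms 5.35/5.40 one ambient dimension up; XXL): `freeLow_of_apexCut`, `rd_of_histApexCut`.
ERRATUM to §3's reading «`TermLow 3` is CJS-transcription»: `TermLow` (v2) contains the states «`|O| = 1`, `e_x(f) = 3`, `p ∣ o`» for which CJS
Thm 5.28 (3e) fails; they belong to `OldExit` (Kawanoue–Matsuki on the old component), which is why v3 cuts by the history FIRST.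

`endOrd_of_rd : RD k m → EndOrd k (m + 1)` — stub E of the line IS the registered door stub one dimension lower (res-D-pv-006 p539872
`NCTransport.exists_winsOrd_orderOne_mul_prod_of_rankDrop`); `rd_succ_of_histApexCut` = the inductive form (RD_{m+1}) ⟸ five pieces + (RD_m).

## §6  BY NAME (v3)
`wildWideApexFourStartsWon_of_histCut : CoreUnaryWild₃ → FreeTame₃ → OldExit₃ → ApexLineCurveExit₃ → ApexPlaneExit₃ → (door text) → W4|₄`
(W4|₄ and the door `stub_spaceNCRankDrop` both VERBATIM from v32), sorry-free; `rd_three_of_histCut` (the five pieces + `RD k 2` give `RD k 3`, which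
T″|₅ consumes through `tameWideApexFiveUpStartsWon_of_ncRankDropBelow`).
-/


set_option linter.dupNamespace false -- mandated namespace of this single-conjunct summit

noncomputable section

open Literature.AlgebraicGeometry.Resolution

namespace Summit.ResolutionOfSingularities.ResolutionOfSingularities.Theorems

/-! ## §4 BY NAME -/

namespace NCTransport

open MvPowerSeries TameFourTupleDrop

/-- **W4|₄ = `stub_wildWideApexFourStartsWon` (v32, statement VERBATIM) FROM THE DIRECTRIX CUT IN 4-SPACE**: the open wild threefold core
`CoreUnaryWild p k 3`, the maximal-contact core `CoreUnaryTame p k 3`, the CJS-regime termination `TermLow k 3`, and the ORDINAL endgame rung `EndOrd k 3`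
(fed by a finite rung via `endOrd_of_endR8`, or by the rank-drop statement one dimension lower — see the card),
over every algebraically closed field of characteristic `p`.  Sorry-free composition: `coreUnary_of_tame_of_wild`, `rd_of_dirCut`,
`wildWideApexFourStartsWon_of_ncRankDrop`. [OURS · L1 W4.3 · line `directrix-cut`] -/
theorem wildWideApexFourStartsWon_of_dirCut
    (hwild : ∀ (p : ℕ), p.Prime → ∀ (k : Type) [Field k] [CharP k p] [IsAlgClosed k], CoreUnaryWild p k 3)
    (htame : ∀ (p : ℕ), p.Prime → ∀ (k : Type) [Field k] [CharP k p] [IsAlgClosed k], CoreUnaryTame p k 3)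
    (hterm : ∀ (p : ℕ), p.Prime → ∀ (k : Type) [Field k] [CharP k p] [IsAlgClosed k], TermLow k 3)
    (hend : ∀ (p : ℕ), p.Prime → ∀ (k : Type) [Field k] [CharP k p] [IsAlgClosed k], EndOrd k 3) :
    ∀ (p : ℕ), p.Prime → ∀ (k : Type) [Field k] [CharP k p] [IsAlgClosed k],
      (∀ m : ℕ, m < 4 → ∀ g : MvPowerSeries (Fin m) k,
        CobordantGame.IsSingular k g → CobordantGame.Won k m g) →
      ∀ (f : MvPowerSeries (Fin 4) k), CobordantGame.IsSingular k f →
      (∀ g : MvPowerSeries (Fin 4) k, CobordantGame.IsSingular k g → g.order < f.order →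
        CobordantGame.Won k 4 g) →
      ∀ (d : ℕ), f.order = d → p ∣ d →
      (∃ ℓ : Fin 4 → k, ∀ i j : Fin 4,
        MvPowerSeries.coeff (Finsupp.single i 1 + Finsupp.single j 1) f =
          MvPowerSeries.coeff (Finsupp.single i 1 + Finsupp.single j 1)
            ((∑ l, MvPowerSeries.C (ℓ l) * MvPowerSeries.X l) ^ 2)) →
      (2 < d → ∃ c₁ c₂ : Fin 4 → k, (∀ α β : k, α • c₁ + β • c₂ = 0 → α = 0 ∧ β = 0) ∧
        (∀ v : Fin 4 → k, CobordantChart.initEval (fun _ : Fin 4 => 1) (v + c₁) d f =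
          CobordantChart.initEval (fun _ : Fin 4 => 1) v d f) ∧
        (∀ v : Fin 4 → k, CobordantChart.initEval (fun _ : Fin 4 => 1) (v + c₂) d f =
          CobordantChart.initEval (fun _ : Fin 4 => 1) v d f)) →
      CobordantGame.Won k 4 f :=
  wildWideApexFourStartsWon_of_ncRankDrop fun p hp k _ _ _ =>
    rd_of_dirCut (coreUnary_of_tame_of_wild (htame p hp k) (hwild p hp k)) (hterm p hp k) (hend p hp k)

/-- **THE TEXT OF `stub_spaceNCRankDrop` (v32, VERBATIM) FROM THE SAME CUT AT `m = 2`**: `CoreUnary 2` (= TOT2-LINE's unary-vertex regime S-E2′),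
`TermLow 2` (S-E1 ∪ S-E0 ∪ S-CRV: `e(f̃) ≤ 1`) and `EndOrd 2` (from R8 = `NCTransport.exists_winsIn_orderOne_mul_prod`, adoption by res-D-pv-006 in
progress, through `endOrd_of_endR8`); equivalently stub-1's `spaceNCRankDrop_of_highPhase_of_rung` with `hhigh` supplied WITH exit by the cut. [OURS · L1 W4.3; offered to the registrar as ONE possible S-ASM shape — not a registration] -/
theorem spaceNCRankDrop_of_dirCut
    (hcore : ∀ (p : ℕ), p.Prime → ∀ (k : Type) [Field k] [CharP k p] [IsAlgClosed k], CoreUnary k 2)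
    (hterm : ∀ (p : ℕ), p.Prime → ∀ (k : Type) [Field k] [CharP k p] [IsAlgClosed k], TermLow k 2)
    (hend : ∀ (p : ℕ), p.Prime → ∀ (k : Type) [Field k] [CharP k p] [IsAlgClosed k], EndOrd k 2) :
    ∀ (p : ℕ), p.Prime → ∀ (k : Type) [Field k] [CharP k p] [IsAlgClosed k],
      ∃ ρ : MvPowerSeries (Fin 3) k → Ordinal.{0}, ∀ b : MvPowerSeries (Fin 3) k, b ≠ 0 → ¬ TameFourTupleDrop.GermIsNC b →
        ∃ (Φ : Fin 3 → MvPowerSeries (Fin 3) k) (w : Fin 3 → ℕ),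
          TameFourTupleDrop.IsCountMove (m := 2) Φ w ∧ TameFourTupleDrop.MoveClause (m := 2) b Φ w (fun b' => ρ b' < ρ b) :=
  fun p hp k _ _ _ => rd_of_dirCut (hcore p hp k) (hterm p hp k) (hend p hp k)


/-- **W4|₄ = `stub_wildWideApexFourStartsWon` (v32, statement VERBATIM) FROM THE HISTORY-FIRST CUT IN 4-SPACE (v3)**: the open wild threefold core
`CoreUnaryWild p k 3` (UNCHANGED), the free tame core `FreeTame p k 3`, the rigid-contact class `OldExit k 3`, the two residual apex pieces
`ApexLineCurveExit k 3` / `ApexPlaneExit k 3` of `FreeLow k 3` (its `e = 0` / `e = 1`-isolated parts being tree theorems), and — in place of the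
ordinal endgame rung `EndOrd k 3` — THE REGISTERED DOOR STUB `stub_spaceNCRankDrop` (v32, statement VERBATIM as `hdoor`; `endOrd_of_rd` =
res-D-pv-006's p539872), over every algebraically closed field of characteristic `p`.  Sorry-free composition: `rd_succ_of_histApexCut`,
`wildWideApexFourStartsWon_of_ncRankDrop`. [OURS · L1 W4.3 · line `directrix-cut` v3] -/
theorem wildWideApexFourStartsWon_of_histCut
    (hwild : ∀ (p : ℕ), p.Prime → ∀ (k : Type) [Field k] [CharP k p] [IsAlgClosed k], CoreUnaryWild p k 3)
    (htame : ∀ (p : ℕ), p.Prime → ∀ (k : Type) [Field k] [CharP k p] [IsAlgClosed k], FreeTame p k 3)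
    (hold : ∀ (p : ℕ), p.Prime → ∀ (k : Type) [Field k] [CharP k p] [IsAlgClosed k], OldExit k 3)
    (hcrv : ∀ (p : ℕ), p.Prime → ∀ (k : Type) [Field k] [CharP k p] [IsAlgClosed k], ApexLineCurveExit k 3)
    (hpl : ∀ (p : ℕ), p.Prime → ∀ (k : Type) [Field k] [CharP k p] [IsAlgClosed k], ApexPlaneExit k 3)
    (hdoor : ∀ (p : ℕ), p.Prime → ∀ (k : Type) [Field k] [CharP k p] [IsAlgClosed k],
      ∃ ρ : MvPowerSeries (Fin 3) k → Ordinal.{0}, ∀ b : MvPowerSeries (Fin 3) k, b ≠ 0 → ¬ TameFourTupleDrop.GermIsNC b →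
        ∃ (Φ : Fin 3 → MvPowerSeries (Fin 3) k) (w : Fin 3 → ℕ),
          TameFourTupleDrop.IsCountMove (m := 2) Φ w ∧ TameFourTupleDrop.MoveClause (m := 2) b Φ w (fun b' => ρ b' < ρ b)) :
    ∀ (p : ℕ), p.Prime → ∀ (k : Type) [Field k] [CharP k p] [IsAlgClosed k],
      (∀ m : ℕ, m < 4 → ∀ g : MvPowerSeries (Fin m) k,
        CobordantGame.IsSingular k g → CobordantGame.Won k m g) →
      ∀ (f : MvPowerSeries (Fin 4) k), CobordantGame.IsSingular k f →
      (∀ g : MvPowerSeries (Fin 4) k, CobordantGame.IsSingular k g → g.order < f.order →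
        CobordantGame.Won k 4 g) →
      ∀ (d : ℕ), f.order = d → p ∣ d →
      (∃ ℓ : Fin 4 → k, ∀ i j : Fin 4,
        MvPowerSeries.coeff (Finsupp.single i 1 + Finsupp.single j 1) f =
          MvPowerSeries.coeff (Finsupp.single i 1 + Finsupp.single j 1)
            ((∑ l, MvPowerSeries.C (ℓ l) * MvPowerSeries.X l) ^ 2)) →
      (2 < d → ∃ c₁ c₂ : Fin 4 → k, (∀ α β : k, α • c₁ + β • c₂ = 0 → α = 0 ∧ β = 0) ∧
        (∀ v : Fin 4 → k, CobordantChart.initEval (fun _ : Fin 4 => 1) (v + c₁) d f =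
          CobordantChart.initEval (fun _ : Fin 4 => 1) v d f) ∧
        (∀ v : Fin 4 → k, CobordantChart.initEval (fun _ : Fin 4 => 1) (v + c₂) d f =
          CobordantChart.initEval (fun _ : Fin 4 => 1) v d f)) →
      CobordantGame.Won k 4 f :=
  wildWideApexFourStartsWon_of_ncRankDrop fun p hp k _ _ _ =>
    haveI : Infinite k := IsAlgClosed.instInfinite
    rd_succ_of_histApexCut (hold p hp k) (hcrv p hp k) (hpl p hp k) (htame p hp k) (hwild p hp k) (hdoor p hp k)

/-- **T″|₅ (the `N = 5` slice of `stub_tameWideApexFiveUpStartsWon`) COSTS THE SAME SIX PIECES**: `tameWideApexFiveUpStartsWon_of_ncRankDropBelow` at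
`n = 0` consumes `RD k 3`, which the five pieces at `m = 3` and the door `RD k 2` give (`rd_three_of_histCut`); a by-name closer needs the
registrar's split of T″|₅₊ into `N = 5` / `N ≥ 6` (offered, not registered here). -/
theorem rd_three_of_histCut (p : ℕ) (_hp : p.Prime) (k : Type) [Field k] [CharP k p] [IsAlgClosed k]
    (hwild : CoreUnaryWild p k 3) (htame : FreeTame p k 3) (hold : OldExit k 3) (hcrv : ApexLineCurveExit k 3) (hpl : ApexPlaneExit k 3)
    (hdoor : RD k 2) : RD k 3 :=
  haveI : Infinite k := IsAlgClosed.instInfinite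
  rd_succ_of_histApexCut hold hcrv hpl htame hwild hdoor


end NCTransport

/-! ## §7 (gen-8 addendum) THE LADDER IN EVERY DIMENSION and THE `T″|₅` SEAM

`rd_all_of_histApexCut`: the ordinal rank drop `RD k m` in EVERY dimension `m + 1 ≥ 3` from the door `RD k 2` and the five history-first pieces in
every dimension `≥ 4` (induction on `m` by `rd_succ_of_histApexCut`).  `tameWideApexFiveStartsWon_of_histCut`: the `N = 5` instance of v32's
`stub_tameWideApexFiveUpStartsWon` (text with `n := 0`) from the SAME six hypotheses as `wildWideApexFourStartsWon_of_histCut` (the tame lift consumes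
the rank drop one dimension below: `TameLift.tameWon_of_tupleDrop` at `m = 4` ∘ `tupleDrop_of_ncRankDrop k 3` ∘ `rd_three_of_histCut`).
The remaining v32 residuals W4|₅₊ / T″|₅₊ follow BY NAME from the door and the five piece-FAMILIES in every dimension (terms at the end of the
section; honest bookkeeping only: for `m + 1 ≥ 5` the pieces FT/OX/PL are no longer in print). -/

namespace TameFourTupleDrop

variable {k : Type} [Field k]

/-- **RD in every dimension** from the door and the five pieces in every dimension above it. -/
theorem rd_all_of_histApexCut [Infinite k] {p : ℕ} (hdoor : RD k 2)
    (hpieces : ∀ m : ℕ, 2 ≤ m →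
      OldExit k (m + 1) ∧ ApexLineCurveExit k (m + 1) ∧ ApexPlaneExit k (m + 1) ∧ FreeTame p k (m + 1) ∧ CoreUnaryWild p k (m + 1)) :
    ∀ m : ℕ, 2 ≤ m → RD k m := by
  intro m hm
  induction m, hm using Nat.le_induction with
  | base => exact hdoor
  | succ m hm ih =>
    obtain ⟨h₁, h₂, h₃, h₄, h₅⟩ := hpieces m hm
    exact rd_succ_of_histApexCut h₁ h₂ h₃ h₄ h₅ ih

end TameFourTupleDrop

namespace NCTransport

open TameFourTupleDrop

/-- **THE `T″|₅` SEAM**: v32's `stub_tameWideApexFiveUpStartsWon` AT `n = 0` (dimension 5, tame order) from the five history-first pieces in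
dimension 4 and the registered door — the SAME hypotheses as `wildWideApexFourStartsWon_of_histCut`.  (Registrar: `stub_tameWideApexFiveUpStartsWon
:= fun p hp k _ _ _ n => match n with | 0 => tameWideApexFiveStartsWon_of_histCut … p hp k | n + 1 => stub_tameWideApexSixUpStartsWon p hp k n`.) -/
theorem tameWideApexFiveStartsWon_of_histCut
    (hwild : ∀ (p : ℕ), p.Prime → ∀ (k : Type) [Field k] [CharP k p] [IsAlgClosed k], CoreUnaryWild p k 3)
    (htame : ∀ (p : ℕ), p.Prime → ∀ (k : Type) [Field k] [CharP k p] [IsAlgClosed k], FreeTame p k 3)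
    (hold : ∀ (p : ℕ), p.Prime → ∀ (k : Type) [Field k] [CharP k p] [IsAlgClosed k], OldExit k 3)
    (hcrv : ∀ (p : ℕ), p.Prime → ∀ (k : Type) [Field k] [CharP k p] [IsAlgClosed k], ApexLineCurveExit k 3)
    (hpl : ∀ (p : ℕ), p.Prime → ∀ (k : Type) [Field k] [CharP k p] [IsAlgClosed k], ApexPlaneExit k 3)
    (hdoor : ∀ (p : ℕ), p.Prime → ∀ (k : Type) [Field k] [CharP k p] [IsAlgClosed k],
      ∃ ρ : MvPowerSeries (Fin 3) k → Ordinal.{0}, ∀ b : MvPowerSeries (Fin 3) k, b ≠ 0 → ¬ TameFourTupleDrop.GermIsNC b →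
        ∃ (Φ : Fin 3 → MvPowerSeries (Fin 3) k) (w : Fin 3 → ℕ),
          TameFourTupleDrop.IsCountMove (m := 2) Φ w ∧ TameFourTupleDrop.MoveClause (m := 2) b Φ w (fun b' => ρ b' < ρ b)) :
    ∀ (p : ℕ), p.Prime → ∀ (k : Type) [Field k] [CharP k p] [IsAlgClosed k],
    (∀ m : ℕ, m < 0 + 5 → ∀ g : MvPowerSeries (Fin m) k,
      CobordantGame.IsSingular k g → CobordantGame.Won k m g) →
    ∀ (f : MvPowerSeries (Fin (0 + 5)) k), CobordantGame.IsSingular k f →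
    (∀ g : MvPowerSeries (Fin (0 + 5)) k, CobordantGame.IsSingular k g → g.order < f.order →
      CobordantGame.Won k (0 + 5) g) →
    ∀ (d : ℕ), f.order = d → ¬ p ∣ d →
    (∃ ℓ : Fin (0 + 5) → k, ∀ i j : Fin (0 + 5),
      MvPowerSeries.coeff (Finsupp.single i 1 + Finsupp.single j 1) f =
        MvPowerSeries.coeff (Finsupp.single i 1 + Finsupp.single j 1)
          ((∑ l, MvPowerSeries.C (ℓ l) * MvPowerSeries.X l) ^ 2)) →
    (2 < d → ∃ c₁ c₂ : Fin (0 + 5) → k, (∀ α β : k, α • c₁ + β • c₂ = 0 → α = 0 ∧ β = 0) ∧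
      (∀ v : Fin (0 + 5) → k, CobordantChart.initEval (fun _ : Fin (0 + 5) => 1) (v + c₁) d f =
        CobordantChart.initEval (fun _ : Fin (0 + 5) => 1) v d f) ∧
      (∀ v : Fin (0 + 5) → k, CobordantChart.initEval (fun _ : Fin (0 + 5) => 1) (v + c₂) d f =
        CobordantChart.initEval (fun _ : Fin (0 + 5) => 1) v d f)) →
    CobordantGame.Won k (0 + 5) f := by
  intro p hp k _ _ _ _ f hf hord d hfd hpd _ _
  exact TameLift.tameWon_of_tupleDrop p hp k 4
    (tupleDrop_of_ncRankDrop k 3 (rd_three_of_histCut p hp k (hwild p hp k) (htame p hp k) (hold p hp k) (hcrv p hp k) (hpl p hp k) (hdoor p hp k)))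
    f hf hord d hfd hpd

/- By-name terms for the remaining v32 residuals from the door `hdoor : ∀ p k, RD k 2` and the piece-families
`hpieces : ∀ p k, ∀ m ≥ 2, OldExit k (m+1) ∧ ApexLineCurveExit k (m+1) ∧ ApexPlaneExit k (m+1) ∧ FreeTame p k (m+1) ∧ CoreUnaryWild p k (m+1)`
(bookkeeping only — above dimension 4 the families are open in print):
  W4|₅₊ := `wildWideApexFiveUpStartsWon_of_ncRankDrop fun p hp k _ _ _ n => haveI : Infinite k := IsAlgClosed.instInfinite;
             rd_all_of_histApexCut (hdoor p hp k) (hpieces p hp k) (n + 4) (by omega)`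
  T″|₅₊ := `tameWideApexFiveUpStartsWon_of_ncRankDropBelow fun p hp k _ _ _ n => haveI : Infinite k := IsAlgClosed.instInfinite;
             rd_all_of_histApexCut (hdoor p hp k) (hpieces p hp k) (n + 3) (by omega)`. -/

end NCTransport

end Summit.ResolutionOfSingularities.ResolutionOfSingularities.Theorems

end
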